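import Summits.BirchSwinnertonDyer.Rank1Residual.O5.HeegnerLogTransportThreeBSDp
import Summits.BirchSwinnertonDyer.Rank1Residual.O5.HeegnerLogTransportThreeHeegnerIndexRow2576l1
import Literature.NumberTheory.EllipticCurves.ManinConstantConductorLe300000
import Literature.NumberTheory.EllipticCurves.ManinConstantSemistablePrimewise
import Literature.NumberTheory.EllipticCurves.CuspFormLFunctionLevelConductorProofs
import Literature.NumberTheory.EllipticCurves.AnalyticRankModularityProofs
import Summits.BirchSwinnertonDyer.Rank1Residual.O5.HeegnerHypothesisOfDiscr
import HarnessLib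
import HarnessLib.Audit.Tags

/-!
# Heegner-log transport at `p = 3` (KL3), part 32e — the two SUPERSINGULAR-companion rows of record
# `23184z1 ~ 2576l1` and `162288ei1 ~ 2576l1` (`K = ℚ(√−551)`, `d_K = −551`) in the cell's closing
# currency: `BSDp 23184z1 3`, `BSDp 162288ei1 3`
# (o5-r2 GEN 33; STAGED: imports part 32 = `O5.HeegnerLogTransportThreeBSDp` (by-sha ask A-O5-G32-1) and
# the 27e ROW `O5.HeegnerLogTransportThreeHeegnerIndexRow2576l1` (typer-staged after the 27e MODELS);
# §1 was farm-checked standalone against BUILT modules in `gen33/scratch/TwistModelsKL3Five_scratch.lean`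
# (rc 0, 0 warnings, axioms standard: the Kraus test at `2` decided in the kernel); §2 is the mechanical
# mirror of part 32d.)

GEN 35 (this file SUPERSEDES the GEN 34 bytes of the same name; o5-r2 GEN 35, memo `HOME/b2b-bsdres-o5-r2/gen35/O5-GEN35.md`):
(1) MAZUR FOR THE COMPANION. The companion-side Manin binder `hc3' : ¬ 3 ∣ c(D')` of the good companion `2576l1` (`N_G = 2576 = 2⁴·7·23`: `3 ∤ N_G`) is discharged
BY NAME from the REFEREED theorem Mazur 1978, Cor. 4.1 = tree named fact `mazur_not_dvd_maninConstant_of_odd`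
(`Literature/NumberTheory/EllipticCurves/ManinConstantSemistablePrimewise.lean`, librarian 2026-08-16, BUILT; Česnavičius 2018 Thm. 1.2 (MK-1),
arXiv:1604.02165 p. 3; consumed likewise by X11b `BDPRouteManin`): globally minimal `G` (MODELS instance), optimal datum (`hopt'` = the fact's own
binder `Λ_E ⊆ c·Λ_f`), `p = 3 ≠ 2`, `¬ 3² ∣ N'` by Carayol (`N' = N_G` from `hmod`, kernel numeral `conductorNorm_G…`) + `norm_num` — NO range
bound, NO database primary, NO registry flag. Change:
`o5_bsdp_row23184z1_manin`, `o5_bsdp_row162288ei1_manin` now use Mazur on the companion side, A321 on the record side ONLY (their flag-free `_mazur` variants —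
record-side `hc3` DISPLAYED — are not staged here: 400-line `lint.size`; elaborated in `gen35/scratch/BSDpMazur_composition_scratch.lean`).
(2) A321 PROVENANCE FLAGS CARRIED (referee A R199.5; REFEREE-2 R2-140.1; registry CITED-FACTS A321 = PUB[sec]): BOTH flags `CRE19-db-primary`
+ `CNS24-range-reading` travel with every displayed `hMan` — spelled out in each `_manin` docstring below; A321 is usable AS PRINTED at
`N ≤ 300000` only, and every A321 instantiation in this file is inside the range AND the narrow ČNS population:
`N(23184z1) = 23184 = 2⁴·3²·7·23`; `N(162288ei1) = 162288 = 2⁴·3²·7²·23` (odd additive prime `3`).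
(3) The Heegner level lemma(s) `satisfiesHeegnerHypothesis_23184_of_discr`, `satisfiesHeegnerHypothesis_162288_of_discr` (GEN 34 edit 3) MOVED, bytes unchanged, to part 35h
`O5/HeegnerHypothesisOfDiscr.lean` (imported; dependency-free, farm-checked rc 0) — no row file imports another row file any more.
No other change of statement; §1/§2 byte-identical to GEN 34.

GEN 34 (superseded the GEN 33 bytes): the binder `hmodE : hasEntireLFunction_rat` (A19) is NO LONGER
DISPLAYED — it is DERIVED from `hmod` by the tree theorem `WeierstrassCurve.hasEntireLFunction_rat_of_exists_isNewformOf`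
(`AnalyticRankModularityProofs.lean`, Diamond–Shurman Thm 8.8.3 + 5.10.2), as the X11b Castella files do; and the Heegner-hypothesis
binders `hH : SatisfiesHeegnerHypothesis N K`, `hH' : … N' K`, `h3K : … 3 K` are NO LONGER DISPLAYED — they are DERIVED IN THE KERNEL:
the decomposition law (`satisfiesHeegnerHypothesis_iff_kronecker`, tree, PROVED; list form `satisfiesHeegnerHypothesis_listProd_of_kronecker`
of part 35h, with the level lemma) + Jacobi symbols `(d_K/p) = 1` (and `d_K ≡ 1 (mod 8)` at `p = 2`) by `norm_num` for the primes of the literal level, Carayol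
(`N = N_W`, `N' = N_G` from `hmod`, the equalities that also bound the companion level for `hMan`) and `SatisfiesHeegnerHypothesis.of_dvd`
(`N_G ∣ N_W`, `3 ∣ N_W`). These rows never displayed `hW20`. No other change of statement.

HONEST FRAMING (cell `b2b-bsdres`, run/shared/lean/b2b/bsd-rank1-residual/, verbatim in every file): the
goal of the cell is to DELETE the COMBINATION-SHAPED residual classes of the Birch–Swinnerton-Dyer
formula for ALL analytic-rank `≤ 1` elliptic curves over `ℚ` — "full BSD formula for every rank `≤ 1`
curve in class `C`" assembled STRICTLY from published theorems — so that the rank-`≤ 1` remainder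
becomes exactly the CONSTRUCTION-SHAPED classes, which are TYPED (missing-input `Prop`s), NOT
attempted. This is not "finishing BSD". Seat o5-r2 (planner 2, non-Iwasawa side) works a RESEARCH ROUTE
on O5 = (t′); **O5 stays OPEN**; no claim beyond the stated rows; every theorem is CONDITIONAL on its
displayed binders; census / instrument statements are EVIDENCE or displayed binders, never a Literature
fact; NOTHING is booked and no mark / label / count / tier of `RESIDUAL-MAP.md` moves.

As in part 32d the companion `G = 2576l1` is SUPERSINGULAR at `3`: the END is part 27e's Heegner-index END
(`o5_index_unit_row23184z1/162288ei1`; the companion's Heegner index DISPLAYED as `hIdx` — EVIDENCE census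
C), `ρ̄_{W,3}` onto is the kernel fact `surj3_W23184z1` / `surj3_W162288ei1` of the 27e MODELS (no `hρ`
binder). Both tree twist models `W.quadraticTwist (−551)` are ALREADY globally minimal (`u = 1`; at `2`:
`v₂ Δ = 12`, `2⁴ ∣ c₄`, and the integer Kraus test refutes a descaled model — decided in the kernel);
conductors `23184·551² = 7038685584`, `162288·551² = 49270799088`.

Record rows (EVIDENCE, `O5/HeegnerIndexRecordsThreeRankOneT1.lean` l.101 / l.351): `23184z1`, `D = −551`,
`m₁ = m₂ = 28`, `#F(ℚ)_tors = 1`, `∏c_ℓ(F) = 4`, `#Ш_an(F) = 49`; `162288ei1`, `D = −551`, `m₁ = m₂ = 8`,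
`#F(ℚ)_tors = 1`, `∏c_ℓ(F) = 8`, `#Ш_an(F) = 1` (so `ord₃ q_d = 0` on both).
§3 (o5-r2 GEN 33 docket (iii) / GEN 35): `o5_bsdp_row23184z1_manin`, `o5_bsdp_row162288ei1_manin` — BOTH Manin binders DISCHARGED BY NAME:
`hc3` (record, `N(23184z1) = 23184 ≤ 300000`; `N(162288ei1) = 162288 ≤ 300000`) from lit GEN 112's A321 `cremona_abs_maninConstant_eq_one_of_level_le_300000`
(p368272; flags `CRE19-db-primary` + `CNS24-range-reading` CARRIED, see the theorem docstrings; via Carayol's level theorem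
`IsNewformOf.level_eq_conductorNorm_of_exists_isNewformOf` + the kernel numerals `conductorNorm_W…`) and `hc3'` (companion `2576l1`, `N' = 2576 = 2⁴·7·23`, `3 ∤ N'`)
from Mazur 1978 Cor. 4.1 (`mazur_not_dvd_maninConstant_of_odd`, refereed, no range, no flag), at the price of the displayed optimality `hopt`, `hopt'`
of the chosen data — NO Manin binder remains. §2 and the GEN 33/34 §3 were elaborated in `gen33/scratch/…` / `gen34/scratch/BSDpNoLemma20_composition_scratch.lean` (rc 0);
the GEN 35 §3 in `gen35/scratch/BSDpMazur_composition_scratch.lean` (rc in `gen35/scratch/CHECKS.md`) as real text over sorried stand-ins for the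
unbuilt END / base rows (signatures verbatim), the Mazur module imported for REAL.

References: as part 32; [CesnaviciusNeururerSaha2023] §1; [Mazur1978] Cor. 4.1; [Cesnavicius2018] Thm. 1.2 (MK-1); [AgasheRibetStein2006] Thm. 2.3, 2.6;
[DiamondShurman2005] Thm. 8.8.1; [CremonaAlgorithms1997] §3.2; [Kraus1989] Prop. 1–2; [SilvermanAEC2009] III.1, VII.1;
memo `HOME/b2b-bsdres-o5-r2/gen33/O5-GEN33.md`.

### cc-typer-5 GEN 21 (O5 §3.5 / O6 §3.4 typer of record) — A-O5-G35-1 (e) of o5-r2 GEN 35 (HOME/INBOX.md l.16133; memo gen35/O5-GEN35.md): ffff25606658f4e7 →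
O5/HeegnerLogTransportThreeBSDpRows2576l1.lean (after (h) + part 32 + 27e MODELS + 27e ROW). Source sha16 `ffff25606658f4e7` (390 l.; `gen35/SHA16.txt`), re-hashed before
writing; THIS file = the source VERBATIM + this paragraph (script `class-closure/typer-5/gen21/gplace21.py`, COMPACT ¶ to respect `lint.size`). Filed for the gate's own
deferral-and-retry: the import `O5.…HeegnerIndexRow2576l1` (p375909, accepted 2026-08-25 ≈ 01:50Z) had no check-farm olean yet, so NO standalone typer check was obtainable (rc 75
`unbuilt`); checks of record = o5-r2's stated farm checks of the identical source (rc 0 / 0 warnings / 0 sorries, axioms standard) + the gate's verification; typer DEDUP none on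
the 14 names + 4 instances; 0 `@[conjecture]`, 0 Literature facts (net debt 0), no `sorry`. HONEST FRAMING (cell `b2b-bsdres`): research route, lane CLASS-CLOSURE §3.5 O5;
CONDITIONAL ENDs, nothing booked, no mark / label / count / tier of `RESIDUAL-MAP.md` moves; census = EVIDENCE, never a Literature fact; O5 OPEN.
-/

set_option autoImplicit false

noncomputable section

open scoped Classical

open WeierstrassCurve Literature.NumberTheory.EllipticCurves
  Literature.NumberTheory.EllipticCurves.ModularForms
  Literature.NumberTheory.EllipticCurves.Rank1Residual
  Literature.NumberTheory.EllipticCurves.Rank1Residual.Typed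
  Literature.NumberTheory.EllipticCurves.KrizLi2019
open Summit.BirchSwinnertonDyer.Rank1Residual.X11b (isGloballyMinimal_of_krausCriterion_support)
open IsDedekindDomain (HeightOneSpectrum)
open scoped NumberField

namespace Summit.BirchSwinnertonDyer.Rank1Residual.O5.HeegnerLogTransport

/-! ## §1 The two twist models (checked standalone, rc 0) -/

namespace KL3HeegnerIndexRows

/-- The tree's model of the quadratic twist `23184z1^(−551)` is already globally minimal (conductor
`7038685584`): `⟨0, 0, 0, d²·b₄/2, d³·b₆/4⟩` with `b₄, b₆ = −109728, 21166272`. [cite: CremonaAlgorithms1997, §3.2] -/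
def Wd23184z1_551 : WeierstrassCurve ℚ := ⟨0, 0, 0, -16656765264, -885195460338768⟩

/-- `Δ(Wd23184z1_551) = −2¹²·3⁹·7⁷·19⁶·23·29⁶ ≠ 0`. [folklore] -/
instance : Wd23184z1_551.IsElliptic := ⟨by
  rw [isUnit_iff_ne_zero]
  norm_num [Wd23184z1_551, WeierstrassCurve.Δ, WeierstrassCurve.b₂, WeierstrassCurve.b₄,
    WeierstrassCurve.b₆, WeierstrassCurve.b₈]⟩

/-- `Wd23184z1_551` is globally minimal: `|Δ| = 2¹²·3⁹·7⁷·19⁶·23·29⁶`; at `2`: `2⁴ ∣ c₄`, `2⁶ ∣ c₆` and the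
integer Kraus test fails for the descaled pair; elsewhere `v_q Δ < 12`.
[cite: SilvermanAEC2009, VII.1 Remark 1.1] [cite: Kraus1989, Prop. 1 and Prop. 2] -/
theorem isGloballyMinimal_Wd23184z1_551 : Wd23184z1_551.IsGloballyMinimal :=
  isGloballyMinimal_of_krausCriterion_support 0 0 0 (-16656765264) (-885195460338768)
    [(2, 4, 12), (3, 2, 9), (7, 1, 7), (19, 2, 6), (23, 1, 1), (29, 2, 6)]
    (by intro t ht; simp only [List.mem_cons, List.not_mem_nil, or_false] at ht
        rcases ht with rfl | rfl | rfl | rfl | rfl | rfl <;> norm_num)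
    (by decide +kernel) (by decide +kernel)

/-- Instance form of `isGloballyMinimal_Wd23184z1_551` (typer lint docstring). [cite: Kraus1989, Prop. 1 and Prop. 2] -/
instance : Wd23184z1_551.IsGloballyMinimal := isGloballyMinimal_Wd23184z1_551

/-- The identity change of variables (`u = 1`). [cite: SilvermanAEC2009, III.1 Table 3.1] -/
def twistChange551Z : VariableChange ℚ := ⟨1, 0, 0, 0⟩

/-- **The twist identity IN THE KERNEL**: `id • 23184z1.quadraticTwist (−551) = Wd23184z1_551`.
[cite: SilvermanAEC2009, III.1 Table 3.1 and X.5 Cor. 5.4] -/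
theorem twist_W23184z1_551 :
    twistChange551Z • W23184z1.quadraticTwist ((-551 : ℤ) : ℚ) = Wd23184z1_551 := by
  ext <;> norm_num [WeierstrassCurve.variableChange_def, WeierstrassCurve.quadraticTwist, W23184z1,
    Wd23184z1_551, twistChange551Z, WeierstrassCurve.b₂, WeierstrassCurve.b₄, WeierstrassCurve.b₆]

/-- `u = 1` for `twistChange551Z`, so `ord₃ u = 0`. [folklore] -/
theorem padicValRat_u_twistChange551Z : padicValRat 3 (twistChange551Z.u : ℚ) = 0 := by
  simp [twistChange551Z]

/-- The tree's model of the quadratic twist `162288ei1^(−551)` is already globally minimal (conductor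
`49270799088`): `b₄, b₆ = 296352, 37340352`. [cite: CremonaAlgorithms1997, §3.2] -/
def Wd162288ei1_551 : WeierstrassCurve ℚ := ⟨0, 0, 0, 44986381776, -1561612270590288⟩

/-- `Δ(Wd162288ei1_551) = −2¹²·3⁹·7⁸·19⁶·23²·29⁶ ≠ 0`. [folklore] -/
instance : Wd162288ei1_551.IsElliptic := ⟨by
  rw [isUnit_iff_ne_zero]
  norm_num [Wd162288ei1_551, WeierstrassCurve.Δ, WeierstrassCurve.b₂, WeierstrassCurve.b₄,
    WeierstrassCurve.b₆, WeierstrassCurve.b₈]⟩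

/-- `Wd162288ei1_551` is globally minimal: `|Δ| = 2¹²·3⁹·7⁸·19⁶·23²·29⁶`; at `2` the integer Kraus test fails
for the descaled pair; elsewhere `v_q Δ < 12`. [cite: SilvermanAEC2009, VII.1 Remark 1.1] [cite: Kraus1989, Prop. 1 and Prop. 2] -/
theorem isGloballyMinimal_Wd162288ei1_551 : Wd162288ei1_551.IsGloballyMinimal :=
  isGloballyMinimal_of_krausCriterion_support 0 0 0 44986381776 (-1561612270590288)
    [(2, 4, 12), (3, 2, 9), (7, 2, 8), (19, 2, 6), (23, 1, 2), (29, 2, 6)]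
    (by intro t ht; simp only [List.mem_cons, List.not_mem_nil, or_false] at ht
        rcases ht with rfl | rfl | rfl | rfl | rfl | rfl <;> norm_num)
    (by decide +kernel) (by decide +kernel)

/-- Instance form of `isGloballyMinimal_Wd162288ei1_551` (typer lint docstring). [cite: Kraus1989, Prop. 1 and Prop. 2] -/
instance : Wd162288ei1_551.IsGloballyMinimal := isGloballyMinimal_Wd162288ei1_551

/-- The identity change of variables (`u = 1`). [cite: SilvermanAEC2009, III.1 Table 3.1] -/
def twistChange551E : VariableChange ℚ := ⟨1, 0, 0, 0⟩

/-- **The twist identity IN THE KERNEL**: `id • 162288ei1.quadraticTwist (−551) = Wd162288ei1_551`.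
[cite: SilvermanAEC2009, III.1 Table 3.1 and X.5 Cor. 5.4] -/
theorem twist_W162288ei1_551 :
    twistChange551E • W162288ei1.quadraticTwist ((-551 : ℤ) : ℚ) = Wd162288ei1_551 := by
  ext <;> norm_num [WeierstrassCurve.variableChange_def, WeierstrassCurve.quadraticTwist, W162288ei1,
    Wd162288ei1_551, twistChange551E, WeierstrassCurve.b₂, WeierstrassCurve.b₄, WeierstrassCurve.b₆]

/-- `u = 1` for `twistChange551E`, so `ord₃ u = 0`. [folklore] -/
theorem padicValRat_u_twistChange551E : padicValRat 3 (twistChange551E.u : ℚ) = 0 := by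
  simp [twistChange551E]

end KL3HeegnerIndexRows

open KL3HeegnerIndexRows

/-! ## §2 The two rows of record over `d_K = −551` (supersingular companion `2576l1`) in closing currency -/

/-- **ROW OF RECORD IN CLOSING CURRENCY (supersingular companion): `BSD(23184z1, 3)`** — part 27e's
Heegner-index END `o5_index_unit_row23184z1` (`W := 23184z1`, `G := 2576l1`) composed with part 32 §1
(`bsdp_of_rankOne_of_indexUnit`): `P`'s non-torsion DERIVED (`r_an(W) = 1`, `q_d ≠ 0`, Gross–Zagier BY NAME),
index finiteness = Kolyvagin BY NAME, `ρ̄_{W,3}` onto = `surj3_W23184z1` (kernel), `3 ∤ ∏c(W)` = `tam3_W23184z1`,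
`u = 1`, minimality in the kernel (§1). Displayed: `hKL`, `hmod`, `hGZK`
(GEN 34: `hmodE` DERIVED from `hmod`; `hH`, `hH'`, `h3K` DERIVED in the kernel); `hGZ`, `hKo`, `hB` (`W/K`);
row data `hr`, Heegner data over `d_K = −551`, `hP'inf`, the companion's Heegner index `hIdx` (EVIDENCE,
census C), `hc3`, `hc3'`, `q_d` (`hqd`, `hqd0`, `hvd`). Conditional theorem; research route; O5 OPEN; nothing booked.
[cite: KrizLi2019, Theorem 1.16 (arXiv:1609.06687v4 pp. 7-8)] [cite: McCallumLMS1991, §1 Theorem (Kolyvagin), p. 296]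
[cite: GrossZagier1986, Thm. I.6.3] [cite: Kolyvagin1990, Thm. A] [cite: CremonaAlgorithms1997, Table 1] -/
theorem o5_bsdp_row23184z1
    (hKL : KrizLi2019.thm116_padicLogHeegner_congruence) (hmod : exists_isNewformOf)
    (hGZK : rank_eq_analyticRank_of_analyticRank_le_one)
    (hr : W23184z1.analyticRank = 1)
    {N N' : ℕ} [NeZero N] [NeZero N'] (D : ModularParametrizationData W23184z1 N)
    (D' : ModularParametrizationData G2576l1 N')
    (K : Type) [Field K] [NumberField K] (hK : IsImaginaryQuadratic K) (hdK : NumberField.discr K = -551)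
    (hGZ : gross_zagier N W23184z1 K) (hKo : kolyvagin N W23184z1 K)
    (hB : Kolyvagin1990_padicValNat_card_sha_le N W23184z1 K)
    (H : HeegnerDatum N (NumberField.discr K)) (H' : HeegnerDatum N' (NumberField.discr K))
    (ι : K →+* ℂ) (ι₃ : K →+* ℚ_[3])
    (P : (W23184z1.baseChange K).toAffine.Point) (P' : (G2576l1.baseChange K).toAffine.Point)
    (hP : WeierstrassCurve.Affine.Point.map ι.toRatAlgHom P = heegnerPointComplex D H)
    (hP' : WeierstrassCurve.Affine.Point.map ι.toRatAlgHom P' = heegnerPointComplex D' H')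
    (hP'inf : ¬ IsOfFinAddOrder P') (hIdx : ¬ 3 ∣ (AddSubgroup.zmultiples P').index)
    (hc3 : ¬ ((3 : ℤ) ∣ D.maninConstant)) (hc3' : ¬ ((3 : ℤ) ∣ D'.maninConstant))
    (qd : ℚ) (hqd : Wd23184z1_551.entireLFunction 1 / (Wd23184z1_551.realPeriodRat : ℂ) = (qd : ℂ))
    (hqd0 : qd ≠ 0) (hvd : padicValRat 3 qd = 0) :
    BSDp W23184z1 3 := by
  have hmodE : hasEntireLFunction_rat := hasEntireLFunction_rat_of_exists_isNewformOf hmod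
  have hN : N = 23184 :=
    (IsNewformOf.level_eq_conductorNorm_of_exists_isNewformOf hmod D.isNewformOf).trans conductorNorm_W23184z1
  have hN' : N' = 2576 :=
    (IsNewformOf.level_eq_conductorNorm_of_exists_isNewformOf hmod D'.isNewformOf).trans conductorNorm_G2576l1
  have hHK : SatisfiesHeegnerHypothesis 23184 K := satisfiesHeegnerHypothesis_23184_of_discr hK.1 hdK
  have hH : SatisfiesHeegnerHypothesis N K := by rw [hN]; exact hHK
  have hH' : SatisfiesHeegnerHypothesis N' K := by rw [hN']; exact hHK.of_dvd (by norm_num)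
  have h3K : SatisfiesHeegnerHypothesis 3 K := hHK.of_dvd (by norm_num)
  have hd : NumberField.discr K < -4 := by rw [hdK]; norm_num
  have hc : ¬ ((3 : ℕ) : ℤ) ∣ D.c := by rw [Nat.cast_ofNat]; exact hc3
  have hWd : twistChange551Z • W23184z1.quadraticTwist (NumberField.discr K : ℚ) = Wd23184z1_551 := by
    rw [hdK]; exact twist_W23184z1_551
  exact bsdp_of_rankOne_of_indexUnit W23184z1 3 N K D H ι P hGZ hKo hB hGZK hmodE hK hH hd hP
    (by decide) hc hr surj3_W23184z1 Wd23184z1_551 twistChange551Z hWd padicValRat_u_twistChange551Z qd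
    hqd hqd0 hvd tam3_W23184z1 fun hPinf =>
      o5_index_unit_row23184z1 hKL hmod D D' K hK hdK hH hH' h3K H H' ι ι₃ P P' hP hP' hPinf hP'inf hIdx
        (padicValInt.eq_zero_of_not_dvd hc3) hc3'

/-- **ROW OF RECORD IN CLOSING CURRENCY (supersingular companion): `BSD(162288ei1, 3)`** — as
`o5_bsdp_row23184z1` with `W := 162288ei1` (part 27e's `o5_index_unit_row162288ei1`, `surj3_W162288ei1`,
`tam3_W162288ei1`). Conditional theorem; research route; O5 OPEN; nothing booked.
[cite: KrizLi2019, Theorem 1.16 (arXiv:1609.06687v4 pp. 7-8) and Rem. 1.17] [cite: McCallumLMS1991, §1 Theorem (Kolyvagin), p. 296]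
[cite: GrossZagier1986, Thm. I.6.3] [cite: Kolyvagin1990, Thm. A] [cite: CremonaAlgorithms1997, Table 1] -/
theorem o5_bsdp_row162288ei1
    (hKL : KrizLi2019.thm116_padicLogHeegner_congruence) (hmod : exists_isNewformOf)
    (hGZK : rank_eq_analyticRank_of_analyticRank_le_one)
    (hr : W162288ei1.analyticRank = 1)
    {N N' : ℕ} [NeZero N] [NeZero N'] (D : ModularParametrizationData W162288ei1 N)
    (D' : ModularParametrizationData G2576l1 N')
    (K : Type) [Field K] [NumberField K] (hK : IsImaginaryQuadratic K) (hdK : NumberField.discr K = -551)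
    (hGZ : gross_zagier N W162288ei1 K) (hKo : kolyvagin N W162288ei1 K)
    (hB : Kolyvagin1990_padicValNat_card_sha_le N W162288ei1 K)
    (H : HeegnerDatum N (NumberField.discr K)) (H' : HeegnerDatum N' (NumberField.discr K))
    (ι : K →+* ℂ) (ι₃ : K →+* ℚ_[3])
    (P : (W162288ei1.baseChange K).toAffine.Point) (P' : (G2576l1.baseChange K).toAffine.Point)
    (hP : WeierstrassCurve.Affine.Point.map ι.toRatAlgHom P = heegnerPointComplex D H)
    (hP' : WeierstrassCurve.Affine.Point.map ι.toRatAlgHom P' = heegnerPointComplex D' H')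
    (hP'inf : ¬ IsOfFinAddOrder P') (hIdx : ¬ 3 ∣ (AddSubgroup.zmultiples P').index)
    (hc3 : ¬ ((3 : ℤ) ∣ D.maninConstant)) (hc3' : ¬ ((3 : ℤ) ∣ D'.maninConstant))
    (qd : ℚ) (hqd : Wd162288ei1_551.entireLFunction 1 / (Wd162288ei1_551.realPeriodRat : ℂ) = (qd : ℂ))
    (hqd0 : qd ≠ 0) (hvd : padicValRat 3 qd = 0) :
    BSDp W162288ei1 3 := by
  have hmodE : hasEntireLFunction_rat := hasEntireLFunction_rat_of_exists_isNewformOf hmod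
  have hN : N = 162288 :=
    (IsNewformOf.level_eq_conductorNorm_of_exists_isNewformOf hmod D.isNewformOf).trans conductorNorm_W162288ei1
  have hN' : N' = 2576 :=
    (IsNewformOf.level_eq_conductorNorm_of_exists_isNewformOf hmod D'.isNewformOf).trans conductorNorm_G2576l1
  have hHK : SatisfiesHeegnerHypothesis 162288 K := satisfiesHeegnerHypothesis_162288_of_discr hK.1 hdK
  have hH : SatisfiesHeegnerHypothesis N K := by rw [hN]; exact hHK
  have hH' : SatisfiesHeegnerHypothesis N' K := by rw [hN']; exact hHK.of_dvd (by norm_num)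
  have h3K : SatisfiesHeegnerHypothesis 3 K := hHK.of_dvd (by norm_num)
  have hd : NumberField.discr K < -4 := by rw [hdK]; norm_num
  have hc : ¬ ((3 : ℕ) : ℤ) ∣ D.c := by rw [Nat.cast_ofNat]; exact hc3
  have hWd : twistChange551E • W162288ei1.quadraticTwist (NumberField.discr K : ℚ) = Wd162288ei1_551 := by
    rw [hdK]; exact twist_W162288ei1_551
  exact bsdp_of_rankOne_of_indexUnit W162288ei1 3 N K D H ι P hGZ hKo hB hGZK hmodE hK hH hd hP
    (by decide) hc hr surj3_W162288ei1 Wd162288ei1_551 twistChange551E hWd padicValRat_u_twistChange551E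
    qd hqd hqd0 hvd tam3_W162288ei1 fun hPinf =>
      o5_index_unit_row162288ei1 hKL hmod D D' K hK hdK hH hH' h3K H H' ι ι₃ P P' hP hP' hPinf hP'inf hIdx
        (padicValInt.eq_zero_of_not_dvd hc3) hc3'

/-! ## §3 The same rows with BOTH Manin binders discharged BY NAME — record side: A321 (lit GEN 112, p368272; flags `CRE19-db-primary` +
`CNS24-range-reading` carried, `N ≤ 300000`); companion side: Mazur 1978 Cor. 4.1 (`mazur_not_dvd_maninConstant_of_odd`)
(o5-r2 GEN 33 docket (iii) / GEN 35) -/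

/-- **Row `23184z1` in closing currency with BOTH Manin binders discharged BY NAME** (o5-r2 GEN 33 docket (iii); GEN 35: Mazur on the
companion side, A321 flags carried on the record side).
RECORD side — `hc3 : ¬ 3 ∣ c(D)` (record `23184z1`, additive at `3`: `N = N(23184z1) = 23184 = 2⁴·3²·7·23`, `3² ∣ N`, so Mazur 1978 Cor. 4.1 does NOT apply) is
REPLACED by the named fact `hMan` = `cremona_abs_maninConstant_eq_one_of_level_le_300000` (lit GEN 112, p368272, `Literature/…/
ManinConstantConductorLe300000.lean`: Cremona's completed verification `|c| = 1` for every optimal curve of conductor `≤ 300000`, as cited in print by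
Česnavičius–Neururer–Saha, JEMS 26 (2024) §1; corollary `not_dvd_maninConstant_of_level_le_300000`) + the optimality `hopt` of the chosen datum
(`Λ_E ⊆ c·Λ_f`, the fact's own binder), the bound `N ≤ 300000` by Carayol's level theorem (from `hmod`) + the kernel numeral `conductorNorm_W23184z1`.
PROVENANCE FLAGS CARRIED WITH `hMan` (registry CITED-FACTS A321, tier PUB[sec]; referee A R199.5; REFEREE-2 R2-140.1 — BOTH flags travel to
every consumer row): `CRE19-db-primary` (the refereed SECONDARY sentence asserts the statement for `N ≤ 300000`; the PRIMARY is Cremona's database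
documentation `ecdata/manin.txt`, unrefereed beyond the Agashe–Ribet–Stein 2006 appendix, A54, bound `130000`) and `CNS24-range-reading` (narrowest
honest reading of the ČNS population = isogeny classes of conductor `≤ 300000` WITH an odd additive prime); usable AS PRINTED at `N ≤ 300000` ONLY.
THIS instantiation is inside the range AND the narrow population: `N = 23184 = 2⁴·3²·7·23 ≤ 300000`, odd additive prime `3`; it is the ONLY A321 use here.
COMPANION side — `hc3' : ¬ 3 ∣ c(D')` (good companion `2576l1`: `N' = N(2576l1) = 2576 = 2⁴·7·23`, `3 ∤ N'`) is REPLACED by the REFEREED theorem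
Mazur 1978, Cor. 4.1 BY NAME: `hMaz` = `mazur_not_dvd_maninConstant_of_odd` (`Literature/NumberTheory/EllipticCurves/
ManinConstantSemistablePrimewise.lean`, librarian 2026-08-16, BUILT; = (MK-1) of Česnavičius 2018 Thm. 1.2, arXiv:1604.02165 p. 3: "for a new elliptic
optimal quotient `π : J₀(n) ↠ E` and a prime `p`, if `ord_p(n) ≤ 1` then `ord_p(c_π) = 0` … (MK-1) if `p` is odd (Mazur, [Maz78] Cor. 4.1)";
consumed the same way by X11b `BDPRouteManin`)
+ the optimality `hopt'` of the chosen companion datum: globally minimal `2576l1` (instance, 27e MODELS `…HeegnerIndexRow2576l1Models` (typer-staged) l.166), `p = 3 ≠ 2` (`decide`),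
`¬ 3² ∣ N'` by Carayol (`N' = 2576`, kernel numeral `conductorNorm_G2576l1`) + `norm_num` — no range bound, no database primary, NO flag.
NO Manin binder remains on this row. Everything else exactly as `o5_bsdp_row23184z1`.
Conditional theorem; research route; O5 OPEN; nothing booked; census rows = EVIDENCE.
[cite: CesnaviciusNeururerSaha2023, §1 (arXiv:1911.09446v3 text chunk 3 L70-72)] [cite: AgasheRibetStein2006, Thm. 2.6]
[cite: Mazur1978, Cor. 4.1] [cite: Cesnavicius2018, Thm. 1.2 (MK-1) (arXiv:1604.02165 text chunk 3 L49-59)]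
[cite: DiamondShurman2005, Thm. 8.8.1] -/
theorem o5_bsdp_row23184z1_manin
    (hKL : KrizLi2019.thm116_padicLogHeegner_congruence) (hmod : exists_isNewformOf)
    (hGZK : rank_eq_analyticRank_of_analyticRank_le_one)
    (hr : W23184z1.analyticRank = 1)
    {N N' : ℕ} [NeZero N] [NeZero N'] (D : ModularParametrizationData W23184z1 N)
    (D' : ModularParametrizationData G2576l1 N')
    (K : Type) [Field K] [NumberField K] (hK : IsImaginaryQuadratic K) (hdK : NumberField.discr K = -551)
    (hGZ : gross_zagier N W23184z1 K) (hKo : kolyvagin N W23184z1 K)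
    (hB : Kolyvagin1990_padicValNat_card_sha_le N W23184z1 K)
    (H : HeegnerDatum N (NumberField.discr K)) (H' : HeegnerDatum N' (NumberField.discr K))
    (ι : K →+* ℂ) (ι₃ : K →+* ℚ_[3])
    (P : (W23184z1.baseChange K).toAffine.Point) (P' : (G2576l1.baseChange K).toAffine.Point)
    (hP : WeierstrassCurve.Affine.Point.map ι.toRatAlgHom P = heegnerPointComplex D H)
    (hP' : WeierstrassCurve.Affine.Point.map ι.toRatAlgHom P' = heegnerPointComplex D' H')
    (hP'inf : ¬ IsOfFinAddOrder P') (hIdx : ¬ 3 ∣ (AddSubgroup.zmultiples P').index)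
    (hMan : cremona_abs_maninConstant_eq_one_of_level_le_300000)
    (hMaz : mazur_not_dvd_maninConstant_of_odd)
    (hopt : ∀ z ∈ D.L.lattice, ∃ w ∈ periodLattice D.f, z = D.c * w)
    (hopt' : ∀ z ∈ D'.L.lattice, ∃ w ∈ periodLattice D'.f, z = D'.c * w)
    (qd : ℚ) (hqd : Wd23184z1_551.entireLFunction 1 / (Wd23184z1_551.realPeriodRat : ℂ) = (qd : ℂ))
    (hqd0 : qd ≠ 0) (hvd : padicValRat 3 qd = 0) :
    BSDp W23184z1 3 :=
  o5_bsdp_row23184z1 hKL hmod hGZK hr D D' K hK hdK hGZ hKo hB H H' ι ι₃ P P' hP hP' hP'inf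
    hIdx
    (not_dvd_maninConstant_of_level_le_300000 hMan W23184z1 D hopt
      (((IsNewformOf.level_eq_conductorNorm_of_exists_isNewformOf hmod D.isNewformOf).trans
        conductorNorm_W23184z1).le.trans (by norm_num)) Nat.prime_three)
    (hMaz G2576l1 D' hopt' 3 Nat.prime_three (by decide)
      (by rw [(IsNewformOf.level_eq_conductorNorm_of_exists_isNewformOf hmod D'.isNewformOf).trans
        conductorNorm_G2576l1]; norm_num))
    qd hqd hqd0 hvd

/-- **Row `162288ei1` in closing currency with BOTH Manin binders discharged BY NAME** (o5-r2 GEN 33 docket (iii); GEN 35: Mazur on the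
companion side, A321 flags carried on the record side).
RECORD side — `hc3 : ¬ 3 ∣ c(D)` (record `162288ei1`, additive at `3`: `N = N(162288ei1) = 162288 = 2⁴·3²·7²·23`, `3² ∣ N`, so Mazur 1978 Cor. 4.1 does NOT apply) is
REPLACED by the named fact `hMan` = `cremona_abs_maninConstant_eq_one_of_level_le_300000` (lit GEN 112, p368272, `Literature/…/
ManinConstantConductorLe300000.lean`: Cremona's completed verification `|c| = 1` for every optimal curve of conductor `≤ 300000`, as cited in print by
Česnavičius–Neururer–Saha, JEMS 26 (2024) §1; corollary `not_dvd_maninConstant_of_level_le_300000`) + the optimality `hopt` of the chosen datum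
(`Λ_E ⊆ c·Λ_f`, the fact's own binder), the bound `N ≤ 300000` by Carayol's level theorem (from `hmod`) + the kernel numeral `conductorNorm_W162288ei1`.
PROVENANCE FLAGS CARRIED WITH `hMan` (registry CITED-FACTS A321, tier PUB[sec]; referee A R199.5; REFEREE-2 R2-140.1 — BOTH flags travel to
every consumer row): `CRE19-db-primary` (the refereed SECONDARY sentence asserts the statement for `N ≤ 300000`; the PRIMARY is Cremona's database
documentation `ecdata/manin.txt`, unrefereed beyond the Agashe–Ribet–Stein 2006 appendix, A54, bound `130000`) and `CNS24-range-reading` (narrowest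
honest reading of the ČNS population = isogeny classes of conductor `≤ 300000` WITH an odd additive prime); usable AS PRINTED at `N ≤ 300000` ONLY.
THIS instantiation is inside the range AND the narrow population: `N = 162288 = 2⁴·3²·7²·23 ≤ 300000`, odd additive prime `3`; it is the ONLY A321 use here.
COMPANION side — `hc3' : ¬ 3 ∣ c(D')` (good companion `2576l1`: `N' = N(2576l1) = 2576 = 2⁴·7·23`, `3 ∤ N'`) is REPLACED by the REFEREED theorem
Mazur 1978, Cor. 4.1 BY NAME: `hMaz` = `mazur_not_dvd_maninConstant_of_odd` (`Literature/NumberTheory/EllipticCurves/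
ManinConstantSemistablePrimewise.lean`, librarian 2026-08-16, BUILT; = (MK-1) of Česnavičius 2018 Thm. 1.2, arXiv:1604.02165 p. 3: "for a new elliptic
optimal quotient `π : J₀(n) ↠ E` and a prime `p`, if `ord_p(n) ≤ 1` then `ord_p(c_π) = 0` … (MK-1) if `p` is odd (Mazur, [Maz78] Cor. 4.1)";
consumed the same way by X11b `BDPRouteManin`)
+ the optimality `hopt'` of the chosen companion datum: globally minimal `2576l1` (instance, 27e MODELS `…HeegnerIndexRow2576l1Models` (typer-staged) l.166), `p = 3 ≠ 2` (`decide`),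
`¬ 3² ∣ N'` by Carayol (`N' = 2576`, kernel numeral `conductorNorm_G2576l1`) + `norm_num` — no range bound, no database primary, NO flag.
NO Manin binder remains on this row. Everything else exactly as `o5_bsdp_row162288ei1`.
Conditional theorem; research route; O5 OPEN; nothing booked; census rows = EVIDENCE.
[cite: CesnaviciusNeururerSaha2023, §1 (arXiv:1911.09446v3 text chunk 3 L70-72)] [cite: AgasheRibetStein2006, Thm. 2.6]
[cite: Mazur1978, Cor. 4.1] [cite: Cesnavicius2018, Thm. 1.2 (MK-1) (arXiv:1604.02165 text chunk 3 L49-59)]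
[cite: DiamondShurman2005, Thm. 8.8.1] -/
theorem o5_bsdp_row162288ei1_manin
    (hKL : KrizLi2019.thm116_padicLogHeegner_congruence) (hmod : exists_isNewformOf)
    (hGZK : rank_eq_analyticRank_of_analyticRank_le_one)
    (hr : W162288ei1.analyticRank = 1)
    {N N' : ℕ} [NeZero N] [NeZero N'] (D : ModularParametrizationData W162288ei1 N)
    (D' : ModularParametrizationData G2576l1 N')
    (K : Type) [Field K] [NumberField K] (hK : IsImaginaryQuadratic K) (hdK : NumberField.discr K = -551)
    (hGZ : gross_zagier N W162288ei1 K) (hKo : kolyvagin N W162288ei1 K)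
    (hB : Kolyvagin1990_padicValNat_card_sha_le N W162288ei1 K)
    (H : HeegnerDatum N (NumberField.discr K)) (H' : HeegnerDatum N' (NumberField.discr K))
    (ι : K →+* ℂ) (ι₃ : K →+* ℚ_[3])
    (P : (W162288ei1.baseChange K).toAffine.Point) (P' : (G2576l1.baseChange K).toAffine.Point)
    (hP : WeierstrassCurve.Affine.Point.map ι.toRatAlgHom P = heegnerPointComplex D H)
    (hP' : WeierstrassCurve.Affine.Point.map ι.toRatAlgHom P' = heegnerPointComplex D' H')
    (hP'inf : ¬ IsOfFinAddOrder P') (hIdx : ¬ 3 ∣ (AddSubgroup.zmultiples P').index)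
    (hMan : cremona_abs_maninConstant_eq_one_of_level_le_300000)
    (hMaz : mazur_not_dvd_maninConstant_of_odd)
    (hopt : ∀ z ∈ D.L.lattice, ∃ w ∈ periodLattice D.f, z = D.c * w)
    (hopt' : ∀ z ∈ D'.L.lattice, ∃ w ∈ periodLattice D'.f, z = D'.c * w)
    (qd : ℚ) (hqd : Wd162288ei1_551.entireLFunction 1 / (Wd162288ei1_551.realPeriodRat : ℂ) = (qd : ℂ))
    (hqd0 : qd ≠ 0) (hvd : padicValRat 3 qd = 0) :
    BSDp W162288ei1 3 :=
  o5_bsdp_row162288ei1 hKL hmod hGZK hr D D' K hK hdK hGZ hKo hB H H' ι ι₃ P P' hP hP'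
    hP'inf hIdx
    (not_dvd_maninConstant_of_level_le_300000 hMan W162288ei1 D hopt
      (((IsNewformOf.level_eq_conductorNorm_of_exists_isNewformOf hmod D.isNewformOf).trans
        conductorNorm_W162288ei1).le.trans (by norm_num)) Nat.prime_three)
    (hMaz G2576l1 D' hopt' 3 Nat.prime_three (by decide)
      (by rw [(IsNewformOf.level_eq_conductorNorm_of_exists_isNewformOf hmod D'.isNewformOf).trans
        conductorNorm_G2576l1]; norm_num))
    qd hqd hqd0 hvd

end Summit.BirchSwinnertonDyer.Rank1Residual.O5.HeegnerLogTransport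

end
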